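import Summits.QuantumAdvantage.QuantumAdvantage.Theorems.CubicForrelationNearExactIsExactAmmCeilingX
import Summits.QuantumAdvantage.QuantumAdvantage.Theorems.NearExactIsExact.Negative.ShapeLemma

/-!
# Direct sums cannot bring a function closer to low degree (LEMMA DS of the gen-31 disproof notes, §39.10)

On the bent branch of the near-exact problem `Φ(f,g) = 1 - 2·#{f ≠ g̃}/2^n` (`g̃` the dual of the bent `g`),
so the value of a bent `g` against the best cubic partner is governed by the distance of `g̃` from the cubics.
For a direct sum `g(x‖y) = g₁(x) ⊕ g₂(y)` the dual is the direct sum of the duals, and this file proves the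
counting fact behind "direct sums cannot raise `Φ`": if every function of degree `≤ r` on `n₁` bits differs
from `d₁` in at least `K` points, then every function of degree `≤ r` on `n₁ + n₂` bits differs from the
direct sum `d₁(x) ⊕ d₂(y)` in at least `2^{n₂}·K` points (slice by `y`; a slice of a degree-`≤ r` function has
degree `≤ r`), and symmetrically for the second summand.  Hence all cubic bent functions built as direct sums on
a small core (the only known cubic bent functions outside the completed Maiorana–McFarland class,
[cite: PolujanPott2020, Thm. 4.9]) are capped by the core's ceiling.  Negative knowledge supporting
`stmt-QuantumAdvantage-14043`; it proves nothing about the summit statement itself. [folklore]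
-/

set_option linter.dupNamespace false -- D-0017: single-problem summit ⇒ `QuantumAdvantage.QuantumAdvantage` by design

namespace Summit.QuantumAdvantage.QuantumAdvantage.Theorems.NearExactIsExact.Negative.DirectSumDistance

open Finset Literature.Computability.QuantumComplexity
open Summit.QuantumAdvantage.QuantumAdvantage.Theorems.CubicForrelation.NearExactIsExact
  (acx_deg_eval acx_deg_slice fc_deg_bxor)
open Summit.QuantumAdvantage.QuantumAdvantage.Theorems.NearExactIsExact.Negative.ShapeLemma (sum_append')

/-- One slice `y = const` of the direct sum already differs from any degree-`≤ r` function `C` in `≥ K`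
points of the slice, because `x ↦ C(x‖y) ⊕ d₂(y)` has degree `≤ r`. [folklore] -/
theorem le_card_slice_ne {n₁ n₂ r K : ℕ} (d₁ : (Fin n₁ → Bool) → Bool) (d₂ : (Fin n₂ → Bool) → Bool)
    (hK : ∀ c : (Fin n₁ → Bool) → Bool, IsDegLeFun r c → K ≤ (univ.filter fun x => d₁ x ≠ c x).card)
    (C : (Fin (n₁ + n₂) → Bool) → Bool) (hC : IsDegLeFun r C) (y : Fin n₂ → Bool) :
    K ≤ (univ.filter fun x : Fin n₁ → Bool => (d₁ x ^^ d₂ y) ≠ C (Fin.append x y)).card := by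
  have hc : IsDegLeFun r (fun x : Fin n₁ → Bool => C (Fin.append x y) ^^ d₂ y) :=
    fc_deg_bxor (acx_deg_eval hC y) (isDegLeFun_const r (d₂ y))
  refine (hK _ hc).trans (card_le_card fun x hx => ?_)
  simp only [mem_filter, mem_univ, true_and] at hx ⊢
  revert hx
  cases d₁ x <;> cases d₂ y <;> cases C (Fin.append x y) <;> simp

/-- The same for slices `x = const` and the second summand. [folklore] -/
theorem le_card_slice_ne' {n₁ n₂ r K : ℕ} (d₁ : (Fin n₁ → Bool) → Bool) (d₂ : (Fin n₂ → Bool) → Bool)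
    (hK : ∀ c : (Fin n₂ → Bool) → Bool, IsDegLeFun r c → K ≤ (univ.filter fun y => d₂ y ≠ c y).card)
    (C : (Fin (n₁ + n₂) → Bool) → Bool) (hC : IsDegLeFun r C) (x : Fin n₁ → Bool) :
    K ≤ (univ.filter fun y : Fin n₂ → Bool => (d₁ x ^^ d₂ y) ≠ C (Fin.append x y)).card := by
  have hc : IsDegLeFun r (fun y : Fin n₂ → Bool => C (Fin.append x y) ^^ d₁ x) :=
    fc_deg_bxor (acx_deg_slice hC x) (isDegLeFun_const r (d₁ x))
  refine (hK _ hc).trans (card_le_card fun y hy => ?_)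
  simp only [mem_filter, mem_univ, true_and] at hy ⊢
  revert hy
  cases d₁ x <;> cases d₂ y <;> cases C (Fin.append x y) <;> simp

/-- **LEMMA DS (first summand).**  If `d₁` is at distance `≥ K` from every function of degree `≤ r` on `n₁`
bits, then the direct sum `z ↦ d₁(z|₁) ⊕ d₂(z|₂)` is at distance `≥ 2^{n₂}·K` from every function of degree
`≤ r` on `n₁ + n₂` bits. [folklore] -/
theorem two_pow_mul_le_card_ne_directSum {n₁ n₂ r K : ℕ} (d₁ : (Fin n₁ → Bool) → Bool)
    (d₂ : (Fin n₂ → Bool) → Bool)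
    (hK : ∀ c : (Fin n₁ → Bool) → Bool, IsDegLeFun r c → K ≤ (univ.filter fun x => d₁ x ≠ c x).card)
    (C : (Fin (n₁ + n₂) → Bool) → Bool) (hC : IsDegLeFun r C) :
    2 ^ n₂ * K ≤ (univ.filter fun z : Fin (n₁ + n₂) → Bool =>
        (d₁ (fun i => z (Fin.castAdd n₂ i)) ^^ d₂ (fun j => z (Fin.natAdd n₁ j))) ≠ C z).card := by
  rw [card_eq_sum_ones, sum_filter, sum_append']
  simp only [Fin.append_left, Fin.append_right]
  rw [sum_comm]
  have hy : ∀ y : Fin n₂ → Bool,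
      K ≤ ∑ x : Fin n₁ → Bool, if (d₁ x ^^ d₂ y) ≠ C (Fin.append x y) then 1 else 0 := fun y => by
    rw [← sum_filter, ← card_eq_sum_ones]
    exact le_card_slice_ne d₁ d₂ hK C hC y
  calc 2 ^ n₂ * K = ∑ _y : Fin n₂ → Bool, K := by
        simp [sum_const, card_univ, Fintype.card_bool, Fintype.card_fin]
    _ ≤ _ := sum_le_sum fun y _ => hy y

/-- **LEMMA DS (second summand).** [folklore] -/
theorem two_pow_mul_le_card_ne_directSum' {n₁ n₂ r K : ℕ} (d₁ : (Fin n₁ → Bool) → Bool)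
    (d₂ : (Fin n₂ → Bool) → Bool)
    (hK : ∀ c : (Fin n₂ → Bool) → Bool, IsDegLeFun r c → K ≤ (univ.filter fun y => d₂ y ≠ c y).card)
    (C : (Fin (n₁ + n₂) → Bool) → Bool) (hC : IsDegLeFun r C) :
    2 ^ n₁ * K ≤ (univ.filter fun z : Fin (n₁ + n₂) → Bool =>
        (d₁ (fun i => z (Fin.castAdd n₂ i)) ^^ d₂ (fun j => z (Fin.natAdd n₁ j))) ≠ C z).card := by
  rw [card_eq_sum_ones, sum_filter, sum_append']
  simp only [Fin.append_left, Fin.append_right]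
  have hx : ∀ x : Fin n₁ → Bool,
      K ≤ ∑ y : Fin n₂ → Bool, if (d₁ x ^^ d₂ y) ≠ C (Fin.append x y) then 1 else 0 := fun x => by
    rw [← sum_filter, ← card_eq_sum_ones]
    exact le_card_slice_ne' d₁ d₂ hK C hC x
  calc 2 ^ n₁ * K = ∑ _x : Fin n₁ → Bool, K := by
        simp [sum_const, card_univ, Fintype.card_bool, Fintype.card_fin]
    _ ≤ _ := sum_le_sum fun x _ => hx x

end Summit.QuantumAdvantage.QuantumAdvantage.Theorems.NearExactIsExact.Negative.DirectSumDistance
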